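import Mathlib.Analysis.InnerProductSpace.Calculus
import Mathlib.Analysis.SpecialFunctions.ExpDeriv
import Mathlib.Analysis.Calculus.Deriv.MeanValue
import HarnessLib

/-!
# Frozen quadratic Lyapunov forms: exponential contraction for time-dependent generators

The last step of every `L²`-hypocoercivity argument (Dolbeault–Mouhot–Schmeiser, *Hypocoercivity for
linear kinetic equations conserving mass*, Trans. AMS 367 (2015), proof of Theorem 2: "`d/dt H[f] ≤
−(2κ/(1+ε)) H[f]` … completing the proof with `λ = κ/(1+ε)` and `C = √((1+ε)/(1−ε))`"; Coti Zelati–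
Gallay, J. LMS 108 (2023), Thm 3.1 ⟹ Cor. 3.3) is the same elementary fact: if a FIXED quadratic form
`v ↦ Re⟪Pv, v⟫`, equivalent to the squared norm (`m‖v‖² ≤ Re⟪Pv,v⟫ ≤ M‖v‖²`), is dissipated at rate
`2λ` along a trajectory `u` of a (possibly TIME-DEPENDENT) linear or nonlinear evolution — i.e.
`2Re⟪P u(s), u̇(s)⟫ ≤ −2λ·Re⟪P u(s), u(s)⟫` — then `‖u(t)‖² ≤ (M/m)·e^{−2λ(t−a)}·‖u(a)‖²`.
Because the form is frozen, the equivalence constants are paid ONCE, not per time step: this is what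
lets a strict Lyapunov functional built for one generator (e.g. the hypocoercivity-index-1 functional
`‖v‖² − 2β Re(v̄₀(Sv)₀)` of Achleitner–Arnold–Mehrmann, ZAMM 2023, §2.4 Algorithm 1) serve a whole
family of generators `D + g(s)S`, `g(s) ∈ [g_lo, g_hi]`, with one `β`.

This file proves the fact in a finite- or infinite-dimensional complex inner-product space `E`, for a
bounded self-adjoint `P : E →L[ℂ] E` and a trajectory given in the `HasDerivWithinAt … (Icc a b)` shape
of `Literature.Analysis.OperatorTheory.GearhartPrussAccretive` and of the Galerkin files of
`Literature.Analysis.FluidPDE` (no semigroup theory):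
* `hasDerivAt_re_inner_self_of_selfAdjoint` — `d/ds Re⟪P u, u⟫ = 2 Re⟪P u, u̇⟫`;
* `antitoneOn_exp_mul_re_inner` — `s ↦ e^{2λ(s−a)} Re⟪P u(s), u(s)⟫` is non-increasing on `[a, b]`;
* `re_inner_le_exp_mul_of_lyapunov` — `Re⟪P u(t), u(t)⟫ ≤ e^{−2λ(t−a)} Re⟪P u(a), u(a)⟫`;
* `norm_sq_le_of_quadratic_lyapunov` — **the contraction** `‖u t‖² ≤ (M/m)e^{−2λ(t−a)}‖u a‖²`.

No definitions, no named facts; everything is proved.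
-/

noncomputable section

namespace Literature.Analysis.OperatorTheory

open scoped InnerProductSpace Real
open _root_.Complex Set Filter
open _root_.Topology

variable {E : Type*} [NormedAddCommGroup E] [InnerProductSpace ℂ E]

/-- For a bounded self-adjoint `P` and a trajectory `u` with derivative `u̇` (within `[a,b]`), the
frozen quadratic form `s ↦ Re⟪P u(s), u(s)⟫` has derivative `2 Re⟪P u(s), u̇(s)⟫` at interior points.
[cite: DolbeaultMouhotSchmeiser2015, §1.3 proof of Thm 2] -/
theorem hasDerivAt_re_inner_self_of_selfAdjoint (P : E →L[ℂ] E)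
    (hP : ∀ v w : E, ⟪P v, w⟫_ℂ = ⟪v, P w⟫_ℂ) {a b : ℝ} {u u' : ℝ → E}
    (hu : ∀ s ∈ Icc a b, HasDerivWithinAt u (u' s) (Icc a b) s) {x : ℝ} (hx : x ∈ Ioo a b) :
    HasDerivAt (fun s => (⟪P (u s), u s⟫_ℂ).re) (2 * (⟪P (u x), u' x⟫_ℂ).re) x := by
  have hux : HasDerivAt u (u' x) x :=
    (hu x (Ioo_subset_Icc_self hx)).hasDerivAt (Icc_mem_nhds hx.1 hx.2)
  have hPu : HasDerivAt (fun s => P (u s)) (P (u' x)) x :=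
    ((P.restrictScalars ℝ).hasFDerivAt).comp_hasDerivAt x hux
  have h := hPu.inner ℂ hux
  have h2 : HasDerivAt (fun s => (⟪P (u s), u s⟫_ℂ).re)
      ((⟪P (u x), u' x⟫_ℂ + ⟪P (u' x), u x⟫_ℂ).re) x :=
    (Complex.reCLM.hasFDerivAt.comp_hasDerivAt x h :)
  refine h2.congr_deriv ?_
  have h3 : (⟪P (u' x), u x⟫_ℂ).re = (⟪P (u x), u' x⟫_ℂ).re := by
    rw [hP, ← inner_conj_symm, Complex.conj_re]
  rw [Complex.add_re, h3]; ring

/-- **Grönwall step for a frozen quadratic Lyapunov form**: if `2Re⟪P u(s), u̇(s)⟫ ≤ −2λ Re⟪P u(s), u(s)⟫`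
on `[a, b]`, then `s ↦ e^{2λ(s−a)}·Re⟪P u(s), u(s)⟫` is non-increasing on `[a, b]`.
[cite: DolbeaultMouhotSchmeiser2015, §1.3 proof of Thm 2] -/
theorem antitoneOn_exp_mul_re_inner (P : E →L[ℂ] E) (hP : ∀ v w : E, ⟪P v, w⟫_ℂ = ⟪v, P w⟫_ℂ)
    {a b : ℝ} {u u' : ℝ → E} (hu : ∀ s ∈ Icc a b, HasDerivWithinAt u (u' s) (Icc a b) s) {lam : ℝ}
    (hdiss : ∀ s ∈ Icc a b, 2 * (⟪P (u s), u' s⟫_ℂ).re ≤ -(2 * lam) * (⟪P (u s), u s⟫_ℂ).re) :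
    AntitoneOn (fun s => Real.exp (2 * lam * (s - a)) * (⟪P (u s), u s⟫_ℂ).re) (Icc a b) := by
  have hcont : ContinuousOn (fun s => Real.exp (2 * lam * (s - a)) * (⟪P (u s), u s⟫_ℂ).re)
      (Icc a b) := by
    refine ContinuousOn.mul (by fun_prop) ?_
    have huc : ContinuousOn u (Icc a b) := fun s hs => (hu s hs).continuousWithinAt
    exact Complex.continuous_re.comp_continuousOn ((P.continuous.comp_continuousOn huc).inner huc)
  refine antitoneOn_of_hasDerivWithinAt_nonpos (convex_Icc a b) hcont
    (f' := fun s => 2 * lam * Real.exp (2 * lam * (s - a)) * (⟪P (u s), u s⟫_ℂ).re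
      + Real.exp (2 * lam * (s - a)) * (2 * (⟪P (u s), u' s⟫_ℂ).re)) ?_ ?_
  · intro x hx
    rw [interior_Icc] at hx ⊢
    have h1 : HasDerivAt (fun s => Real.exp (2 * lam * (s - a)))
        (2 * lam * Real.exp (2 * lam * (x - a))) x := by
      have h := (((hasDerivAt_id x).sub_const a).const_mul (2 * lam)).exp
      simp only [id, mul_one] at h
      exact h.congr_deriv (by ring)
    have h2 := hasDerivAt_re_inner_self_of_selfAdjoint P hP hu hx
    exact (h1.mul h2).hasDerivWithinAt
  · intro x hx
    rw [interior_Icc] at hx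
    have hd := hdiss x (Ioo_subset_Icc_self hx)
    have hexp : 0 < Real.exp (2 * lam * (x - a)) := Real.exp_pos _
    nlinarith [mul_le_mul_of_nonneg_left hd hexp.le]

/-- Exponential decay of the frozen form: `Re⟪P u(t), u(t)⟫ ≤ e^{−2λ(t−a)}·Re⟪P u(a), u(a)⟫` for
`t ∈ [a, b]`. [cite: DolbeaultMouhotSchmeiser2015, §1.3 proof of Thm 2] -/
theorem re_inner_le_exp_mul_of_lyapunov (P : E →L[ℂ] E) (hP : ∀ v w : E, ⟪P v, w⟫_ℂ = ⟪v, P w⟫_ℂ)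
    {a b : ℝ} {u u' : ℝ → E} (hu : ∀ s ∈ Icc a b, HasDerivWithinAt u (u' s) (Icc a b) s) {lam : ℝ}
    (hdiss : ∀ s ∈ Icc a b, 2 * (⟪P (u s), u' s⟫_ℂ).re ≤ -(2 * lam) * (⟪P (u s), u s⟫_ℂ).re)
    {t : ℝ} (ht : t ∈ Icc a b) :
    (⟪P (u t), u t⟫_ℂ).re ≤ Real.exp (-(2 * lam) * (t - a)) * (⟪P (u a), u a⟫_ℂ).re := by
  have hmono := antitoneOn_exp_mul_re_inner P hP hu hdiss
  have ha : a ∈ Icc a b := left_mem_Icc.2 (ht.1.trans ht.2)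
  have h := hmono ha ht ht.1
  simp only [sub_self, mul_zero, Real.exp_zero, one_mul] at h
  have hexp : 0 < Real.exp (2 * lam * (t - a)) := Real.exp_pos _
  rw [show -(2 * lam) * (t - a) = -(2 * lam * (t - a)) by ring, Real.exp_neg]
  rw [le_inv_mul_iff₀ hexp]
  linarith

/-- **Frozen quadratic Lyapunov form ⇒ exponential contraction in norm, with the condition number
paid once.** Let `P` be bounded self-adjoint with `m‖v‖² ≤ Re⟪Pv, v⟫` and `Re⟪Pv, v⟫ ≤ M‖v‖²`
(`m > 0`), and let `u` be differentiable on `[a, b]` with `2Re⟪P u(s), u̇(s)⟫ ≤ −2λ·Re⟪P u(s), u(s)⟫`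
there (the generator may depend on `s`; only the form is frozen). Then for `t ∈ [a, b]`,
`‖u(t)‖² ≤ (M/m)·e^{−2λ(t−a)}·‖u(a)‖²`. [cite: DolbeaultMouhotSchmeiser2015, §1.3 Thm 2 (proof: equivalence (1∓ε)/2 and C = √((1+ε)/(1−ε)))] -/
theorem norm_sq_le_of_quadratic_lyapunov (P : E →L[ℂ] E) (hP : ∀ v w : E, ⟪P v, w⟫_ℂ = ⟪v, P w⟫_ℂ)
    {m M : ℝ} (hm : 0 < m) (hPl : ∀ v : E, m * ‖v‖ ^ 2 ≤ (⟪P v, v⟫_ℂ).re)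
    (hPu : ∀ v : E, (⟪P v, v⟫_ℂ).re ≤ M * ‖v‖ ^ 2) {a b : ℝ} {u u' : ℝ → E}
    (hu : ∀ s ∈ Icc a b, HasDerivWithinAt u (u' s) (Icc a b) s) {lam : ℝ}
    (hdiss : ∀ s ∈ Icc a b, 2 * (⟪P (u s), u' s⟫_ℂ).re ≤ -(2 * lam) * (⟪P (u s), u s⟫_ℂ).re)
    {t : ℝ} (ht : t ∈ Icc a b) :
    ‖u t‖ ^ 2 ≤ M / m * Real.exp (-(2 * lam) * (t - a)) * ‖u a‖ ^ 2 := by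
  have h := re_inner_le_exp_mul_of_lyapunov P hP hu hdiss ht
  have hexp : 0 < Real.exp (-(2 * lam) * (t - a)) := Real.exp_pos _
  have h1 := hPl (u t)
  have h2 := mul_le_mul_of_nonneg_left (hPu (u a)) hexp.le
  rw [div_mul_eq_mul_div, div_mul_eq_mul_div, le_div_iff₀ hm]
  nlinarith

end Literature.Analysis.OperatorTheory

end
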